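import Summits.QuantumFields.YangMills.Theorems.BalabanUVNodesN15SmallFieldSiteLayerLive
import Summits.QuantumFields.YangMills.Theorems.BalabanUVNodesN15SmallFieldKnitConcrete
import HarnessLib

/-!
# N15 = NE2 — Σ-col (J-d): THE KNIT `Live ∧ N15At` OF dag-n15-c's LIVE SMALL-FIELD FAMILY WITH THE OPERATOR AND THE SITE LAYERS READING THE NON-ABELIAN POTENTIAL
# (dag-n15-a g29, programme Σ-col, FILE (J-d); node N15 = NE2; `--supports stmt-QuantumFields-27366 --as helper`, count-neutral; one plumbing `def` (the `NE2Objects₁₁` literal) + theorems)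

WHY ∕ WHAT.  FILE (J-c) `ne2PlusSite_foSiteSf` made the SITE layer of dag-n15-c's live family read `A′`; Σ-F `ne2PlusOperator_sf₄cov` (n15-c FILE 145) is its OPERATOR layer, all four (3.42)
entries reading `A′`; S-D `ne2PlusUnit_covOnS` the re-based (2.156) UNIT kernel (U-blind on this carrier — needs b06's bond elimination ⊗ colour, not in the tree, said); Σ-E `live_sf` the
guard.  ★★ `n15At_sf_of_operator_site` (the socket: operator + site layers BY NAME ⟹ `N15At`, unit = S-D's), ★★★ `live_and_n15At_sf₄cov_siteLive` knits them: `Live ∧ N15At ⟨SfIdx, c₃₅, p, sfInstance, sfFamily … (sfE₄cov …), foSiteSf …, covOnS …, ⊤, dist⟩`; def `sfObjects₄covSite` (the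
`NE2Objects₁₁` literal) + `rfl` + `live_and_n15At_sfObjects₄covSite` + keyed face `s_N15_of_admits_sf₄covSite` (part 30's interface).

HONEST FRAMING ∕ LIMITS.  Bookkeeping over LANDED rows + (J-c); MODEL objects as n15-c FILE 130∕133∕145 — NOT [B9] Thms 3.1∕3.2∕(3.132) as printed; unit layer U-blind here; `inΛ := fun _ _ => True` —
[B9] §E's Dirichlet region `Λ ⊂ Λ_k` (Thm 3.15) is NOT modelled: the whole torus counts as «in Λ», so the unit conjunct is claimed at EVERY bond pair (a STRONGER statement than the printed
localised one, nothing smuggled; v1.0.1 doc-only clause, ref-B READ-986 NIT (b); the same holds for S-D's and (L-5)'s families).  N15 stays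
DISCHARGED OF RECORD AS CONSUMED (U-blind v7 pin, p687738) — no re-pin asked, nothing re-claimed, no count moved (typed 28∕28 · discharged 8∕28); K3⁸ OPEN; one finite 𝕋⁴ at fixed ε per
index — NOT ℝ⁴ ∕ infinite volume ∕ OS ∕ mass gap ∕ Clay.  One plumbing `def` ⇒ review ∕ audit lane.  No `sorry`, `instance`, `notation`, `maxHeartbeats`; standard axioms.
-/

noncomputable section

open scoped BigOperators Matrix Matrix.Norms.Frobenius Kronecker

namespace Summit.QuantumFields.YangMills.BalabanUVNodes.N15.SiteLayerSf

open Literature.MathematicalPhysics.QuantumFieldTheory.Balaban1983to89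
open Literature.MathematicalPhysics.QuantumFieldTheory.Balaban1983to89.T4Continuum (T4Family ULoop)
open Literature.MathematicalPhysics.QuantumFieldTheory.Balaban1983to89.T4EtaRate (PairedInstance NE2PlusOperator NE2PlusSite NE2PlusUnit)
open Literature.MathematicalPhysics.QuantumFieldTheory.Balaban1983to89.B5Prop11Plancherel (Tor fine)
open Literature.Barriers.QuantumFields (traceForm)
open Node00 (NE2Objects₁₁)
open Summit.QuantumFields.YangMills.BalabanUVNodes.N15.OperatorReadout (opGeo)
open Summit.QuantumFields.YangMills.BalabanUVNodes.N15.MatrixSpecies (liftBlk)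
open Summit.QuantumFields.YangMills.BalabanUVNodes.N15.Gluing (SfIdx sfInstance sfFamily CvX CvX' cvM cvBlk)
open Summit.QuantumFields.YangMills.BalabanUVNodes.N15.GenuineRecord (sfTG covOnS ne2PlusUnit_covOnS live_sf sfE₄cov ne2PlusOperator_sf₄cov)
open Summit.QuantumFields.YangMills.BalabanUVNodes.N15.AtKeyedHome (s_N15_of_admits)
open Summit.QuantumFields.YangMills.BalabanUVNodes.N15.PairedFamilyGuard (Live)
open YMDAG.UVSplit (Datum RateCarriers RateRecordPred N15At S_N15 ne2OfRecord₁₁)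

variable (d : ℕ) {L : ℕ} [NeZero L] (mm ι : Type) [Fintype mm] [DecidableEq mm] [Fintype ι] [DecidableEq ι] (a : ℝ) (e : Matrix mm mm ℂ ≃L[ℝ] (ι → ℝ))

/-! ## The knit: `Live ∧ N15At` for dag-n15-c's family with OPERATOR and SITE layers U-live; the `NE2Objects₁₁` literal; keyed face -/

section Knit

omit [DecidableEq mm] [DecidableEq ι] in
/-- ★★ **THE SOCKET: OPERATOR LAYER AND SITE LAYER BY NAME ⟹ `N15At` ON dag-n15-c's FAMILY** (`d ≥ 1`, `L ≥ 2`; ANY operator family `Kop` and ANY site kernel `Ksite` on `sfInstance`,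
directions `α′ β′`, letters `c₃₅`, `p`): the UNIT conjunct is S-D `ne2PlusUnit_covOnS` (the re-based (2.156) kernel; U-blind on this carrier, said).  For later producers of U-live
site kernels on this carrier (and for §1 itself). [bookkeeping] -/
theorem n15At_sf_of_operator_site (hd : 1 ≤ d) (hL2 : 2 ≤ L) (hL : Odd L ∧ 1 < L) (α' β' : Fin (d + 1)) {c35 : ℝ} (p : ℝ)
    (Kop : ∀ i, B9.KernelFamily (sfInstance d mm ι hL i).gc (sfInstance d mm ι hL i).Bf) (Ksite : ∀ i, B9.SiteKernel (sfInstance d mm ι hL i).gc (sfInstance d mm ι hL i).Bf)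
    (hop : NE2PlusOperator c35 (sfInstance d mm ι hL) Kop) (hsite : NE2PlusSite 4 p c35 (sfInstance d mm ι hL) Ksite) :
    N15At { I := SfIdx d L, c35 := c35, p := p, pi := sfInstance d mm ι hL, Kop := Kop, Ksite := Ksite,
            Kunit := covOnS d hL α' β' (sfTG d) (fun i => (L : ℝ) ^ i.m) (fun i => CvX d L i.m i.kk hL × ι) (fun i => liftBlk (cvBlk d L i.m i.kk hL) ι)
              (fun i => (sfInstance d mm ι hL i).Bf),
            inΛ := fun _ _ => True, unitDist := fun i => (sfInstance d mm ι hL i).gc.dist } :=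
  ⟨hop, hsite,
    ne2PlusUnit_covOnS (d := d) hL (sfTG d) (fun i => (L : ℝ) ^ i.m) (fun i => CvX d L i.m i.kk hL × ι) (fun i => liftBlk (cvBlk d L i.m i.kk hL) ι)
      (fun i => (sfInstance d mm ι hL i).gf) (fun i => (sfInstance d mm ι hL i).Bc) (fun i => (sfInstance d mm ι hL i).Bf) hd hL2 (fun _ => Nat.succ_pos _)
      (fun i => (sfInstance d mm ι hL i).pair) α' β' c35⟩

/-- ★★★ **`Live ∧ N15At` FOR dag-n15-c's LIVE SMALL-FIELD FAMILY WITH THE OPERATOR AND THE SITE LAYERS READING `A′`** — `d ≥ 1`, odd `L ≥ 7`, `a, c₃₅ > 0`, trace-form-orthonormal `e`, `ι`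
nonempty, directions `μ₁ μ₂` (operator entries 1–2), `α β j j′` (site bonds∕colours), `α′ β′` (unit bonds), any `p`: OPERATOR = Σ-F `ne2PlusOperator_sf₄cov` (n15-c FILE 145, all four (3.42)
entries), SITE = §2 `ne2PlusSite_foSiteSf`, UNIT = S-D `ne2PlusUnit_covOnS` (the re-based (2.156) kernel; U-blind on this carrier, said); GUARD = Σ-E `live_sf`. [bookkeeping] -/
theorem live_and_n15At_sf₄cov_siteLive [Nonempty ι] (hd : 1 ≤ d) (hL : Odd L ∧ 1 < L) (hL7 : 7 ≤ L) (ha : 0 < a) {c35 : ℝ} (hc35 : 0 < c35)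
    (he : ∀ A B : Matrix mm mm ℂ, traceForm A B = e A ⬝ᵥ e B) (μ₁ μ₂ α β : Fin (d + 1)) (j j' : ι) (α' β' : Fin (d + 1)) (p : ℝ) :
    Live ⟨SfIdx d L, c35, p, sfInstance d mm ι hL, fun i => sfFamily d mm ι a e hL i (sfE₄cov d mm ι a e hL μ₁ μ₂ i), foSiteSf d mm ι a e hL α β j j',
        covOnS d hL α' β' (sfTG d) (fun i => (L : ℝ) ^ i.m) (fun i => CvX d L i.m i.kk hL × ι) (fun i => liftBlk (cvBlk d L i.m i.kk hL) ι) (fun i => (sfInstance d mm ι hL i).Bf),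
        fun _ _ => True, fun i => (sfInstance d mm ι hL i).gc.dist⟩ ∧
      N15At { I := SfIdx d L, c35 := c35, p := p, pi := sfInstance d mm ι hL, Kop := fun i => sfFamily d mm ι a e hL i (sfE₄cov d mm ι a e hL μ₁ μ₂ i),
              Ksite := foSiteSf d mm ι a e hL α β j j',
              Kunit := covOnS d hL α' β' (sfTG d) (fun i => (L : ℝ) ^ i.m) (fun i => CvX d L i.m i.kk hL × ι) (fun i => liftBlk (cvBlk d L i.m i.kk hL) ι)
                (fun i => (sfInstance d mm ι hL i).Bf),
              inΛ := fun _ _ => True, unitDist := fun i => (sfInstance d mm ι hL i).gc.dist } :=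
  ⟨live_sf d mm ι hL hc35.le p _ _ _,
    n15At_sf_of_operator_site d mm ι hd (by omega) hL α' β' p _ _ (ne2PlusOperator_sf₄cov d mm ι e hL hL7 ha hc35 he μ₁ μ₂)
      (ne2PlusSite_foSiteSf d mm ι a e hL hL7 ha hc35 he α β j j' 4 p)⟩

/-- **THE ROAD-(c) LITERAL WITH THE SITE LAYER U-LIVE**: `NE2Objects₁₁` with n15-c's family, Σ-F's operator layer, §1's site kernel, S-D's unit kernel. [bookkeeping] -/
def sfObjects₄covSite (hL : Odd L ∧ 1 < L) (μ₁ μ₂ α β : Fin (d + 1)) (j j' : ι) (α' β' : Fin (d + 1)) (c35 p : ℝ) : NE2Objects₁₁ :=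
  ⟨SfIdx d L, c35, p, sfInstance d mm ι hL, fun i => sfFamily d mm ι a e hL i (sfE₄cov d mm ι a e hL μ₁ μ₂ i), foSiteSf d mm ι a e hL α β j j',
    covOnS d hL α' β' (sfTG d) (fun i => (L : ℝ) ^ i.m) (fun i => CvX d L i.m i.kk hL × ι) (fun i => liftBlk (cvBlk d L i.m i.kk hL) ι) (fun i => (sfInstance d mm ι hL i).Bf),
    fun _ _ => True, fun i => (sfInstance d mm ι hL i).gc.dist⟩

/-- the record map reads the literal as the rates bundle (`rfl`). [bookkeeping] -/
theorem ne2OfRecord₁₁_sfObjects₄covSite (hL : Odd L ∧ 1 < L) (μ₁ μ₂ α β : Fin (d + 1)) (j j' : ι) (α' β' : Fin (d + 1)) (c35 p : ℝ) :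
    ne2OfRecord₁₁ (sfObjects₄covSite d mm ι a e hL μ₁ μ₂ α β j j' α' β' c35 p) =
      { I := SfIdx d L, c35 := c35, p := p, pi := sfInstance d mm ι hL, Kop := fun i => sfFamily d mm ι a e hL i (sfE₄cov d mm ι a e hL μ₁ μ₂ i),
        Ksite := foSiteSf d mm ι a e hL α β j j',
        Kunit := covOnS d hL α' β' (sfTG d) (fun i => (L : ℝ) ^ i.m) (fun i => CvX d L i.m i.kk hL × ι) (fun i => liftBlk (cvBlk d L i.m i.kk hL) ι) (fun i => (sfInstance d mm ι hL i).Bf),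
        inΛ := fun _ _ => True, unitDist := fun i => (sfInstance d mm ι hL i).gc.dist } := rfl

/-- ★★★ **GUARD ∧ `N15At` AT THE LITERAL** (`d ≥ 1`, odd `L ≥ 7`, `a, c₃₅ > 0`, trace-form-orthonormal `e`, `ι` nonempty). [bookkeeping] -/
theorem live_and_n15At_sfObjects₄covSite [Nonempty ι] (hd : 1 ≤ d) (hL : Odd L ∧ 1 < L) (hL7 : 7 ≤ L) (ha : 0 < a) {c35 : ℝ} (hc35 : 0 < c35)
    (he : ∀ A B : Matrix mm mm ℂ, traceForm A B = e A ⬝ᵥ e B) (μ₁ μ₂ α β : Fin (d + 1)) (j j' : ι) (α' β' : Fin (d + 1)) (p : ℝ) :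
    Live (ne2OfRecord₁₁ (sfObjects₄covSite d mm ι a e hL μ₁ μ₂ α β j j' α' β' c35 p)) ∧ N15At (ne2OfRecord₁₁ (sfObjects₄covSite d mm ι a e hL μ₁ μ₂ α β j j' α' β' c35 p)) :=
  live_and_n15At_sf₄cov_siteLive d mm ι a e hd hL hL7 ha hc35 he μ₁ μ₂ α β j j' α' β' p

variable {N : ℕ} [NeZero N] {key : (F : T4Family) → Datum F N → Prop}

/-- ★★ **THE LITERAL AT ANY KEYED HOME** (part 30's interface): a rate home over ANY key admitting only the literals of a key-indexed NE2 reading whose value everywhere is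
`sfObjects₄covSite …` has `S_N15 RRec` (`d ≥ 1`, odd `L ≥ 7`, `a, c₃₅ > 0`, trace-form-orthonormal `e`, `ι` nonempty). [bookkeeping] -/
theorem s_N15_of_admits_sf₄covSite [Nonempty ι] (hd : 1 ≤ d) (hL : Odd L ∧ 1 < L) (hL7 : 7 ≤ L) (ha : 0 < a) {c35 : ℝ} (hc35 : 0 < c35)
    (he : ∀ A B : Matrix mm mm ℂ, traceForm A B = e A ⬝ᵥ e B) (μ₁ μ₂ α β : Fin (d + 1)) (j j' : ι) (α' β' : Fin (d + 1)) (p : ℝ)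
    (ne2At : ∀ {F : T4Family} {D : Datum F N}, key F D → (ℕ → ℝ) → List (ULoop F) → ℕ → NE2Objects₁₁) (RRec : RateRecordPred N)
    (hadm : ∀ (F : T4Family) (D : Datum F N) (g₀ : ℕ → ℝ) (os : List (ULoop F)) (R : RateCarriers N), RRec F D g₀ os R →
      ∃ (h : key F D) (k : ℕ), R.ne2 = ne2OfRecord₁₁ (ne2At h g₀ os k))
    (h : ∀ (F : T4Family) (D : Datum F N) (h : key F D) (g₀ : ℕ → ℝ) (os : List (ULoop F)) (k : ℕ), ne2At h g₀ os k = sfObjects₄covSite d mm ι a e hL μ₁ μ₂ α β j j' α' β' c35 p) :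
    S_N15 RRec :=
  s_N15_of_admits ne2At RRec hadm fun F D hk g₀ os k => by
    rw [h F D hk g₀ os k]; exact (live_and_n15At_sfObjects₄covSite d mm ι a e hd hL hL7 ha hc35 he μ₁ μ₂ α β j j' α' β' p).2

end Knit

end Summit.QuantumFields.YangMills.BalabanUVNodes.N15.SiteLayerSf

end
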